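import Literature.Probability.RandomPlanarGeometry.SAWPatternFiniteMemoryCheck
import HarnessLib

/-!
# Memory-18 pattern-tilted certificate: tight U-turn at tilt `t = 11/5` (`native_decide`)

Topic `Literature/Probability/RandomPlanarGeometry` (an instance of `FiniteMemory.checkPC`,
`SAWPatternFiniteMemoryCheck.lean`). One compiled evaluation of
`FiniteMemory.checkPC 18 1 11 5 15054 1000 80`: the breadth-first search finds the `336 168` normal
forms of the memory-18 Pönitz–Tittmann automaton on `ℤ²`, 80 rounds of weighted integer power
iteration propose a weight vector, and the verified checker confirms closure and the
pattern-weighted Collatz–Wielandt inequalities with letter weight `11` on a letter completing a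
tight U-turn and `5` otherwise, ratio `15054/1000`. Certified (by
`sum_sawWords_patW_mul_pow_le_of_checkPC`): `Σ_{w ∈ sawWords n} 11^{#uturns(w)} 5^{n-#uturns(w)} · 1000ⁿ ≤ 15054ⁿ · 2⁴¹`,
i.e. **`Σ_{SAW_n} (11/5)^{#uturns} ≤ 2⁴¹ · (3.0108)ⁿ`** (telemetry `ratioPC`: `15053803`·10⁻⁶ at `K = 18`). Used by the turn-density windows (`SAWTurnDensityWindowZ2.lean`). The only
non-standard axiom is `Lean.ofReduceBool`; the evaluation takes ≈ 330 s.
[cite: PonitzTittmann2000, §3; MadrasSlade1993, §7.2]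
-/

namespace Literature.Probability.RandomPlanarGeometry.SAW.FiniteMemory

/-- The memory-18 tight U-turn-tilted certificate at `t = 11/5`: `checkPC 18 1 11 5 15054 1000 80`.
[cite: PonitzTittmann2000, §3] -/
theorem checkPC_18_uturn_11_5 : checkPC 18 1 11 5 15054 1000 80 = true := by
  native_decide

end Literature.Probability.RandomPlanarGeometry.SAW.FiniteMemory
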